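import Literature.Geometry.GeometricMeasureTheory.IntegralCurrentsFlatCompactnessDimOne
import HarnessLib

/-!
# The closure theorem in dimension zero, and compactness from the rectifiability of weak limits

Federer's closure theorem [Federer1969, 4.2.16 (1)] ("`𝐈_{m,K}(ℝⁿ)` is `𝐅_K` closed in
`𝐍_{m,K}(ℝⁿ)`") is proved there by slicing with distance functions (4.2.1) and, for `m > 0`, by
the structure theory behind 4.2.15. Its case `m = 0` — flat limits of finite `ℤ`-chains
`Σ n(x) δ_x` of bounded mass are finite `ℤ`-chains — is elementary, and is proved here in the
weak-convergence form by compactness of configurations instead of slicing (a shorter road to the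
same statement): a rectifiable `0`-current of mass `≤ N` supported in `K` is
`φ ↦ Σ_{a < N} k(a) φ(p(a))` with `p(a) ∈ K ∪ {0}` and `|k(a)| ≤ N` (`IntegralCurrentsDimZero.lean`:
`𝓡_0(V)` = the finite `ℤ`-chains), the multiplicity vectors `k` range over a finite set and the
position vectors `p` over the compact set `(K ∪ {0})^N`, so along a subsequence the multiplicities
are constant and the positions converge, and the weak limit is the finite chain sitting at the
limit positions.

* `Current.IsRectifiable.exists_fin_repr_zero` — the padded normal form
  `T(φ) = Σ_{a : Fin N} k(a) φ(p(a))` of a finite `0`-chain of mass `≤ N`;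
* `Current.exists_finset_eq_of_tendsto_zero`, **`Current.isRectifiable_of_tendsto_zero`** — the
  closure theorem in dimension `0`: weak limits of mass-bounded sequences in `𝓡_0(V) = 𝐈_0(V)`
  supported in a fixed compact set are finite `ℤ`-chains;
* `Current.isRectifiable_boundary_of_tendsto_one` — hence a weak limit of an `𝐍`-bounded sequence
  in `𝐈_1(V)` supported in a compact set has RECTIFIABLE BOUNDARY (the boundary clause of the
  closure theorem in dimension `1`);
* **`Federer1969_compactness_of_rectifiableLimit`** — the named fact
  `Federer1969_compactness_integralCurrents` follows from the RECTIFIABILITY of weak limits of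
  `𝐍`-bounded (`𝐍 ≤ c < ∞`) sequences of integral currents supported in compact sets alone: the
  boundary clause of the closure hypothesis of `Federer1969_compactness_of_closure`
  (`IntegralCurrentsFlatCompactnessDimOne.lean`) is discharged, in dimension `1` by the above and in
  dimensions `≥ 2` by applying the rectifiability hypothesis to the boundaries, which form an
  `𝐍`-bounded sequence of integral cycles converging weakly to the boundary of the limit.

Theorems only; no definitions, no named facts.

## References

* H. Federer, *Geometric Measure Theory*, Grundlehren 153, Springer 1969, 4.1.24, 4.1.25, 4.1.28,
  4.2.16, 4.2.17 [Federer1969].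
-/

noncomputable section

open scoped ENNReal NNReal Topology
open MeasureTheory TopologicalSpace Set Filter Metric Function

namespace Literature.Geometry.GeometricMeasureTheory

set_option maxSynthPendingDepth 2

variable {V : Type*} [NormedAddCommGroup V] [InnerProductSpace ℝ V] [FiniteDimensional ℝ V]
  [MeasurableSpace V] [BorelSpace V]

/-! ### Padded normal form of a finite `0`-chain -/

section NormalForm

/-- **Padded normal form of a finite `0`-chain.** A rectifiable `0`-current `T ∈ 𝓡_0(V)` of mass
`𝐌(T) ≤ N` evaluates as `T(φ) = Σ_{a : Fin N} k(a) φ(p(a))` for `N` points `p(a)` (points of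
`spt T`, or the padding value `0` carrying multiplicity `k(a) = 0`) and integer multiplicities with
`|k(a)| ≤ N`: write `T = [F, n] = Σ_{x ∈ F} n(x) δ_x`
(`Current.IsRectifiable.exists_finset_eq_currentOfIntegration`), discard the points of multiplicity
`0`, and count `#{x ∈ F : n(x) ≠ 0} ≤ Σ_{x ∈ F} |n(x)| = 𝐌(T) ≤ N`.
[cite: Federer1969, 4.1.25, 4.1.28 (4)] -/
theorem Current.IsRectifiable.exists_fin_repr_zero {T : Current (⊤ : Opens V) 0}
    (hT : T.IsRectifiable) {N : ℕ} (hN : T.mass ≤ N) :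
    ∃ (p : Fin N → V) (k : Fin N → ℤ), (∀ a, p a ∈ insert (0 : V) T.support) ∧
      (∀ a, (k a).natAbs ≤ N) ∧
      ∀ φ : TestForm (⊤ : Opens V) 0, T φ = ∑ a, (k a : ℝ) * φ (p a) ![] := by
  classical
  obtain ⟨F, n, hFspt, hTF, hmass⟩ := hT.exists_finset_eq_currentOfIntegration
  -- `Σ_{x ∈ F} |n x| ≤ N` as natural numbers
  have hsumN : ∑ x ∈ F, (n x).natAbs ≤ N := by
    have h : ((∑ x ∈ F, (n x).natAbs : ℕ) : ℝ≥0∞) ≤ N := by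
      rw [Nat.cast_sum, ← hmass]; exact hN
    exact_mod_cast h
  -- the points of nonzero multiplicity
  set F' : Finset V := F.filter fun x => n x ≠ 0 with hF'
  have hF'F : F' ⊆ F := Finset.filter_subset _ _
  have hcard : F'.card ≤ N := by
    refine le_trans ?_ hsumN
    calc F'.card = ∑ x ∈ F', 1 := Finset.card_eq_sum_ones _
      _ ≤ ∑ x ∈ F', (n x).natAbs :=
          Finset.sum_le_sum fun x hx =>
            Nat.one_le_iff_ne_zero.2 (Int.natAbs_ne_zero.2 (Finset.mem_filter.1 hx).2)
      _ ≤ ∑ x ∈ F, (n x).natAbs := Finset.sum_le_sum_of_subset hF'F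
  -- enumerate them by the first `#F'` indices of `Fin N`, pad the rest with `(0, 0)`
  set e : Fin F'.card ≃ ↥F' := F'.equivFin.symm
  set emb : Fin F'.card → Fin N := Fin.castLE hcard
  have hemb : Injective emb := Fin.castLE_injective hcard
  refine ⟨extend emb (fun b => (e b : V)) (fun _ => 0), extend emb (fun b => n (e b)) (fun _ => 0),
    fun a => ?_, fun a => ?_, fun φ => ?_⟩
  · by_cases ha : ∃ b, emb b = a
    · obtain ⟨b, rfl⟩ := ha
      rw [hemb.extend_apply]
      exact mem_insert_of_mem _ (hFspt (Finset.mem_coe.2 (hF'F (e b).2)))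
    · rw [extend_apply' _ _ _ ha]
      exact mem_insert _ _
  · by_cases ha : ∃ b, emb b = a
    · obtain ⟨b, rfl⟩ := ha
      rw [hemb.extend_apply]
      exact (Finset.single_le_sum (f := fun x => (n x).natAbs) (fun _ _ => Nat.zero_le _)
        (hF'F (e b).2)).trans hsumN
    · rw [extend_apply' _ _ _ ha]
      simp
  · rw [hTF, currentOfIntegration_finset_apply]
    calc ∑ x ∈ F, (n x : ℝ) * φ x ![]
        = ∑ x ∈ F', (n x : ℝ) * φ x ![] := by
          rw [hF', Finset.sum_filter_of_ne]
          intro x _ hx h0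
          exact hx (by rw [h0, Int.cast_zero, zero_mul])
      _ = ∑ b : Fin F'.card, (n (e b) : ℝ) * φ (e b) ![] := by
          rw [← Finset.sum_coe_sort F']
          exact (Fintype.sum_equiv e _ _ fun b => rfl).symm
      _ = ∑ a ∈ Finset.univ.image emb,
            ((extend emb (fun b => n (e b)) (fun _ => (0 : ℤ)) a : ℤ) : ℝ) *
              φ (extend emb (fun b => (e b : V)) (fun _ => 0) a) ![] := by
          rw [Finset.sum_image hemb.injOn]
          refine Finset.sum_congr rfl fun b _ => ?_
          rw [hemb.extend_apply, hemb.extend_apply]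
      _ = ∑ a, ((extend emb (fun b => n (e b)) (fun _ => (0 : ℤ)) a : ℤ) : ℝ) *
            φ (extend emb (fun b => (e b : V)) (fun _ => 0) a) ![] := by
          refine Finset.sum_subset (Finset.subset_univ _) fun a _ ha => ?_
          have ha' : ¬∃ b, emb b = a := fun ⟨b, hb⟩ =>
            ha (Finset.mem_image.2 ⟨b, Finset.mem_univ _, hb⟩)
          rw [extend_apply' _ _ _ ha']
          simp

omit [InnerProductSpace ℝ V] [FiniteDimensional ℝ V] [MeasurableSpace V] [BorelSpace V] in
/-- Subsequences of padded configurations: if the position vectors `p i : Fin N → V` stay in a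
compact set `K` and the multiplicity vectors `k i : Fin N → ℤ` are bounded by `N`, then along a
subsequence the multiplicities are CONSTANT (finitely many values: a pigeonhole,
`exists_strictMono_forall_apply_eq`) and the positions converge (sequential compactness of `K^N`).
This is the compactness of `𝐈_{0,K} ∩ {𝐌 ≤ N}` behind [Federer1969, 4.2.17 (2)] for `m = 0`.
[cite: Federer1969, 4.2.17 (2)] -/
theorem exists_subseq_fin_config {N : ℕ} {K : Set V} (hK : IsCompact K) (p : ℕ → Fin N → V)
    (k : ℕ → Fin N → ℤ) (hp : ∀ i a, p i a ∈ K) (hk : ∀ i a, (k i a).natAbs ≤ N) :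
    ∃ (ι : ℕ → ℕ) (q : Fin N → V) (k' : Fin N → ℤ), StrictMono ι ∧ (∀ j, k (ι j) = k') ∧
      Tendsto (fun j => p (ι j)) atTop (𝓝 q) := by
  -- the multiplicity vectors range over a finite set: constant along a subsequence
  set S : Finset (Fin N → ℤ) := Fintype.piFinset fun _ => Finset.Icc (-(N : ℤ)) N with hS
  have hkS : ∀ i, k i ∈ S := fun i => by
    rw [hS, Fintype.mem_piFinset]
    intro a
    have h1 : |k i a| ≤ (N : ℤ) := by
      rw [Int.abs_eq_natAbs]
      exact_mod_cast hk i a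
    exact Finset.mem_Icc.2 (abs_le.1 h1)
  obtain ⟨ι₁, hι₁, h₁⟩ :=
    exists_strictMono_forall_apply_eq (β := fun _ : ℕ => ↥S) fun _ i => ⟨k i, hkS i⟩
  have hk₁ : ∀ j, k (ι₁ j) = k (ι₁ 0) := fun j => congrArg Subtype.val (h₁ 0 j (Nat.zero_le j))
  -- the position vectors range over the compact set `K^N`: convergent along a further subsequence
  obtain ⟨q, -, ι₂, hι₂, hq⟩ := (isCompact_univ_pi fun _ : Fin N => hK).tendsto_subseq
    (x := fun j => p (ι₁ j)) fun j => mem_univ_pi.2 fun a => hp _ a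
  exact ⟨ι₁ ∘ ι₂, q, k (ι₁ 0), hι₁.comp hι₂, fun j => hk₁ (ι₂ j), hq⟩

end NormalForm

/-! ### The closure theorem in dimension zero -/

section Closure

/-- **The closure theorem in dimension `0`, with the limit chain** [Federer1969, 4.2.16 (1) for
`m = 0`, in the weak-convergence form]: if `Tᵢ ∈ 𝓡_0(V) = 𝐈_0(V)` are finite `ℤ`-chains with
`spt Tᵢ ⊆ K` compact and `𝐌(Tᵢ) ≤ c < ∞`, converging weakly to a `0`-current `T'`, then `T'` is
a finite `ℤ`-chain `[F, n]`. Proof by compactness of configurations (normal form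
`Current.IsRectifiable.exists_fin_repr_zero`, subsequence `exists_subseq_fin_config`, continuity
of test forms, uniqueness of weak limits, and merging of coincident limit positions), in place of
Federer's slicing argument "`(T ⌞ E_r)(1) = lim (Qᵢ ⌞ E_r)(1) ∈ ℤ`".
[cite: Federer1969, 4.2.16 (1), 4.1.25] -/
theorem Current.exists_finset_eq_of_tendsto_zero {K : Set V} (hK : IsCompact K) {c : ℝ≥0∞}
    (hc : c ≠ ⊤) {T : ℕ → Current (⊤ : Opens V) 0} {T' : Current (⊤ : Opens V) 0}
    (hT : ∀ i, (T i).IsRectifiable ∧ (T i).support ⊆ K ∧ (T i).mass ≤ c)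
    (hconv : ∀ φ, Tendsto (fun i => T i φ) atTop (𝓝 (T' φ))) :
    ∃ (F : Finset V) (n : V → ℤ), T' = currentOfIntegration ↑F n fun _ => ![] := by
  classical
  -- a natural bound for the masses
  obtain ⟨N, hcN⟩ : ∃ N : ℕ, c ≤ (N : ℝ≥0∞) :=
    ⟨⌈c.toReal⌉₊, by
      calc c = ENNReal.ofReal c.toReal := (ENNReal.ofReal_toReal hc).symm
        _ ≤ ENNReal.ofReal (⌈c.toReal⌉₊ : ℝ) := ENNReal.ofReal_le_ofReal (Nat.le_ceil _)
        _ = (⌈c.toReal⌉₊ : ℝ≥0∞) := ENNReal.ofReal_natCast _⟩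
  -- padded normal forms of the terms
  choose p k hp hk hrepr using fun i => (hT i).1.exists_fin_repr_zero ((hT i).2.2.trans hcN)
  -- constant multiplicities and convergent positions along a subsequence
  obtain ⟨ι, q, k', hι, hk', hq⟩ := exists_subseq_fin_config (hK.insert 0) p k
    (fun i a => insert_subset_insert (hT i).2.1 (hp i a)) hk
  -- the weak limit along the subsequence is the chain at the limit positions
  have hlim : ∀ φ : TestForm (⊤ : Opens V) 0, T' φ = ∑ a, (k' a : ℝ) * φ (q a) ![] := by
    intro φ
    have hφc : Continuous fun x : V => φ x ![] :=
      (continuous_eval_const (![] : Fin 0 → V)).comp φ.continuous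
    have h2 : (fun j => T (ι j) φ) = fun j => ∑ a, (k' a : ℝ) * φ (p (ι j) a) ![] := by
      funext j
      rw [hrepr, hk' j]
    have h1 : Tendsto (fun j => T (ι j) φ) atTop (𝓝 (∑ a, (k' a : ℝ) * φ (q a) ![])) := by
      rw [h2]
      refine tendsto_finsetSum _ fun a _ => tendsto_const_nhds.mul ?_
      exact (hφc.tendsto (q a)).comp (((continuous_apply a).tendsto q).comp hq)
    exact tendsto_nhds_unique ((hconv φ).comp hι.tendsto_atTop) h1
  -- merge coincident limit positions
  refine ⟨Finset.univ.image q, fun x => ∑ a ∈ Finset.univ.filter (fun a => q a = x), k' a, ?_⟩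
  ext φ
  rw [hlim φ, currentOfIntegration_finset_apply]
  symm
  calc ∑ x ∈ Finset.univ.image q,
        ((∑ a ∈ Finset.univ.filter (fun a => q a = x), k' a : ℤ) : ℝ) * φ x ![]
      = ∑ x ∈ Finset.univ.image q, ∑ a ∈ Finset.univ.filter (fun a => q a = x),
          (k' a : ℝ) * φ (q a) ![] := by
        refine Finset.sum_congr rfl fun x _ => ?_
        rw [Int.cast_sum, Finset.sum_mul]
        refine Finset.sum_congr rfl fun a ha => ?_
        rw [(Finset.mem_filter.1 ha).2]
    _ = ∑ a, (k' a : ℝ) * φ (q a) ![] :=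
        Finset.sum_fiberwise_of_maps_to (fun a _ => Finset.mem_image_of_mem q (Finset.mem_univ a)) _

/-- **The closure theorem in dimension `0`** [Federer1969, 4.2.16 (1) for `m = 0`:
"`𝐈_{0,K}(ℝⁿ)` is `𝐅_K` closed in `𝐍_{0,K}(ℝⁿ)`", in the weak-convergence form]: a weak limit of
finite `ℤ`-chains `Tᵢ ∈ 𝓡_0(V) = 𝐈_0(V)` with `spt Tᵢ ⊆ K` compact and `𝐌(Tᵢ) ≤ c < ∞` is a
finite `ℤ`-chain, i.e. a rectifiable (`=` integral) `0`-current. [cite: Federer1969, 4.2.16 (1)] -/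
theorem Current.isRectifiable_of_tendsto_zero {K : Set V} (hK : IsCompact K) {c : ℝ≥0∞}
    (hc : c ≠ ⊤) {T : ℕ → Current (⊤ : Opens V) 0} {T' : Current (⊤ : Opens V) 0}
    (hT : ∀ i, (T i).IsRectifiable ∧ (T i).support ⊆ K ∧ (T i).mass ≤ c)
    (hconv : ∀ φ, Tendsto (fun i => T i φ) atTop (𝓝 (T' φ))) : T'.IsRectifiable := by
  obtain ⟨F, n, hT'⟩ := Current.exists_finset_eq_of_tendsto_zero hK hc hT hconv
  rw [hT']
  exact isRectifiable_currentOfIntegration_finset F n fun _ _ => trivial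

/-- The integral form of the closure theorem in dimension `0` (`𝐈_0 = 𝓡_0`).
[cite: Federer1969, 4.2.16 (1), 4.1.24] -/
theorem Current.isIntegral_of_tendsto_zero {K : Set V} (hK : IsCompact K) {c : ℝ≥0∞}
    (hc : c ≠ ⊤) {T : ℕ → Current (⊤ : Opens V) 0} {T' : Current (⊤ : Opens V) 0}
    (hT : ∀ i, (T i).IsIntegral ∧ (T i).support ⊆ K ∧ (T i).mass ≤ c)
    (hconv : ∀ φ, Tendsto (fun i => T i φ) atTop (𝓝 (T' φ))) : T'.IsIntegral :=
  Current.isRectifiable_of_tendsto_zero hK hc hT hconv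

/-- **The boundary clause of the closure theorem in dimension `1`.** A weak limit `T'` of integral
`1`-currents `Tᵢ ∈ 𝐈_1(V)` with `spt Tᵢ ⊆ K` compact and `𝐍(Tᵢ) ≤ c < ∞` has rectifiable
boundary `∂T' ∈ 𝓡_0(V)`: the boundaries `∂Tᵢ ∈ 𝓡_0(V)` have `spt ⊆ K`, `𝐌(∂Tᵢ) ≤ 𝐍(Tᵢ) ≤ c` and
converge weakly to `∂T'`, so the closure theorem in dimension `0` applies.
[cite: Federer1969, 4.2.16 (1)] -/
theorem Current.isRectifiable_boundary_of_tendsto_one {K : Set V} (hK : IsCompact K) {c : ℝ≥0∞}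
    (hc : c ≠ ⊤) {T : ℕ → Current (⊤ : Opens V) 1} {T' : Current (⊤ : Opens V) 1}
    (hT : ∀ i, (T i).IsIntegral ∧ (T i).support ⊆ K ∧ (T i).normalMass ≤ c)
    (hconv : ∀ φ, Tendsto (fun i => T i φ) atTop (𝓝 (T' φ))) : T'.boundary.IsRectifiable :=
  Current.isRectifiable_of_tendsto_zero hK hc (T := fun i => (T i).boundary)
    (fun i => ⟨(hT i).1.2, (T i).support_boundary_subset.trans (hT i).2.1,
      le_add_self.trans (hT i).2.2⟩)
    (Current.tendsto_boundary_apply hconv)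

omit [FiniteDimensional ℝ V] in
/-- **The boundary clause of the closure theorem in dimension `k + 2`, from rectifiability of weak
limits in dimension `k + 1`.** If weak limits of `𝐍`-bounded (`𝐍 ≤ c`, the given `c < ∞`)
sequences of integral `(k+1)`-currents supported in the compact set `K` are rectifiable, then a
weak limit `T'` of integral `(k+2)`-currents `Tᵢ` with `spt Tᵢ ⊆ K`, `𝐍(Tᵢ) ≤ c` has rectifiable
boundary: the boundaries `∂Tᵢ` are integral CYCLES (`∂∂Tᵢ = 0`) with `spt ⊆ K`,
`𝐍(∂Tᵢ) = 𝐌(∂Tᵢ) ≤ 𝐍(Tᵢ) ≤ c`, converging weakly to `∂T'`. [cite: Federer1969, 4.2.16 (1)] -/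
theorem Current.isRectifiable_boundary_of_tendsto_succ {k : ℕ} {K : Set V} {c : ℝ≥0∞}
    (hrect : ∀ (S : ℕ → Current (⊤ : Opens V) (k + 1)) (S' : Current (⊤ : Opens V) (k + 1)),
      (∀ i, (S i).IsIntegral ∧ (S i).support ⊆ K ∧ (S i).normalMass ≤ c) →
      (∀ φ, Tendsto (fun i => S i φ) atTop (𝓝 (S' φ))) → S'.IsRectifiable)
    {T : ℕ → Current (⊤ : Opens V) (k + 1 + 1)} {T' : Current (⊤ : Opens V) (k + 1 + 1)}
    (hT : ∀ i, (T i).IsIntegral ∧ (T i).support ⊆ K ∧ (T i).normalMass ≤ c)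
    (hconv : ∀ φ, Tendsto (fun i => T i φ) atTop (𝓝 (T' φ))) : T'.boundary.IsRectifiable := by
  have hB : ∀ i, (T i).boundary.IsIntegral ∧ (T i).boundary.support ⊆ K ∧
      (T i).boundary.normalMass ≤ c := fun i => by
    refine ⟨⟨(hT i).1.2, ?_⟩, (T i).support_boundary_subset.trans (hT i).2.1, ?_⟩
    · rw [Current.boundary_boundary]
      exact Current.isRectifiable_zero
    · show (T i).boundary.mass + (T i).boundary.boundary.mass ≤ c
      rw [Current.boundary_boundary, Current.mass_zero, add_zero]
      exact le_add_self.trans (hT i).2.2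
  exact hrect (fun i => (T i).boundary) T'.boundary hB (Current.tendsto_boundary_apply hconv)

end Closure

/-! ### Compactness from the rectifiability of weak limits, all dimensions -/

section Reduction

universe u

/-- **Federer–Fleming compactness 4.2.17 (2) follows from the rectifiability of weak limits alone.**
If weak limits of `𝐍`-bounded (`𝐍 ≤ c < ∞`) sequences of integral currents supported in a compact
set are RECTIFIABLE (the principal assertion of Federer's closure theorem
[Federer1969, 4.2.16 (1) with (3)], the hypothesis `hrect`, not proved in this tree), then the
named fact `Federer1969_compactness_integralCurrents` holds: the boundary clause of the closure
hypothesis of `Federer1969_compactness_of_closure` is discharged by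
`Current.isRectifiable_boundary_of_tendsto_one` in dimension `1` (the closure theorem in dimension
`0`, proved above) and by `Current.isRectifiable_boundary_of_tendsto_succ` in dimensions `≥ 2`;
the flat-convergent subsequences with all bounds come from
`Current.exists_subseq_flatLimit_of_isIntegral_one` and `Current.exists_subseq_flatLimit_of_isIntegral`.
[cite: Federer1969, 4.2.17 (2), 4.2.16 (1)] -/
theorem Federer1969_compactness_of_rectifiableLimit
    (hrect : ∀ (V : Type u) [NormedAddCommGroup V] [InnerProductSpace ℝ V]
      [FiniteDimensional ℝ V] [MeasurableSpace V] [BorelSpace V] (m : ℕ) (K : Set V),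
      IsCompact K → ∀ (c : ℝ≥0∞), c ≠ ⊤ → ∀ (T : ℕ → Current (⊤ : Opens V) (m + 1))
        (T' : Current (⊤ : Opens V) (m + 1)),
        (∀ i, (T i).IsIntegral ∧ (T i).support ⊆ K ∧ (T i).normalMass ≤ c) →
        (∀ φ, Tendsto (fun i => T i φ) atTop (𝓝 (T' φ))) → T'.IsRectifiable) :
    Federer1969_compactness_integralCurrents.{u} := by
  intro V _ _ _ _ _ m x₀ ρ c hc T hT
  cases m with
  | zero =>
    obtain ⟨T', ι, hι, -, hspt, hN, hflat, hweak⟩ :=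
      Current.exists_subseq_flatLimit_of_isIntegral_one x₀ ρ hc T hT
    exact ⟨T', ι, hι,
      ⟨hrect V 0 _ (isCompact_closedBall x₀ ρ) c hc (fun j => T (ι j)) T' (fun j => hT (ι j))
          hweak,
        Current.isRectifiable_boundary_of_tendsto_one (isCompact_closedBall x₀ ρ) hc
          (fun j => hT (ι j)) hweak⟩,
      hspt, hN, hflat⟩
  | succ k =>
    obtain ⟨T', ι, hι, -, hspt, hN, hflat, hweak⟩ :=
      Current.exists_subseq_flatLimit_of_isIntegral k x₀ ρ hc T hT
    exact ⟨T', ι, hι,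
      ⟨hrect V (k + 1) _ (isCompact_closedBall x₀ ρ) c hc (fun j => T (ι j)) T'
          (fun j => hT (ι j)) hweak,
        Current.isRectifiable_boundary_of_tendsto_succ
          (hrect V k _ (isCompact_closedBall x₀ ρ) c hc) (fun j => hT (ι j)) hweak⟩,
      hspt, hN, hflat⟩

end Reduction

end Literature.Geometry.GeometricMeasureTheory
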